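import Summits.QuantumFields.QCD.Theorems.EulerDescentRetypedContinuumComplementHeavyCalibrationTransfer
import Summits.QuantumFields.QCD.Theorems.EulerDescentRetypedContinuumComplementHeavyCalibrationSubTensor
import Summits.QuantumFields.QCD.Theorems.GapBuysCauchyRateRotationRestorationLatticeInvariancePassesToLimit
import Literature.MathematicalPhysics.QuantumFieldTheory.SchwingerLimitInheritance
import Literature.MathematicalPhysics.QuantumFieldTheory.OSData
import HarnessLib

/-!
# Heavy transfer: convergence and rotation inheritance of a calibrated family from a convergent
# reference scheme with convergent renormalisation ratios
(helper of stub `stub_heavyCalibration`, line `vitali-mass-descent`, crux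
`Summit.QuantumFields.QCD.Theses.EulerDescent.RetypedContinuumComplement`, item stmt-QuantumFields-16903)

This file proves the heavy-end mechanism of the stub CONDITIONALLY ON ITS TWO SEAMS, for an arbitrary
calibrated species family `𝒞` over `reg` and an arbitrary tuple `m`.  Data: a reference scheme
`reg.scheme m zb shiftb` over the same `(reg, m)` which IS QCD along OS data `T`
(`IsQCDAlong`: its `n`-point functions converge to `T.schwinger` on off-diagonal real tensors) — at a
heavy tuple this is the crux's heavy body.  Hypotheses = the seams, and nothing else:
(Z) the zero-point function `Z/Z` of the reference scheme is eventually `1` (the fermionic-gauge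
partition function does not vanish for large `k`); (R) `zb` never vanishes and every renormalisation
RATIO `𝒞.z(m,s,k)/zb(s,k)` converges as `k → ∞`.  Conclusions:

* `tendsto_calibrated_heavy` — every calibrated `n`-point function on an off-diagonal real tensor tuple
  converges along the FULL sequence, to the explicit limit
  `(∏ᵢ Λ_{σᵢ}) · Σ_B (−1)^{|Bᶜ|} (∏_{i ∉ B} 𝔖₁^T(σᵢ; fᵢ)) · 𝔖^T_{|B|}(σ ∘ e_B; ⊗_{j} f_{e_B j})`
  (the transfer identity `calibrated_transfer`, the heavy body at every sub-string — sub-tensors of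
  off-diagonal tensors are off-diagonal, `isOffDiagonal_subTensor_ofRealTest`, and strings with a
  vanishing factor off `B` contribute `0` on both sides);
* `heavyLimit_linAct` — that limit is invariant under proper rotations of the tuple, because E1 is a
  FIELD of `T` (`T.invariant.2`) and tensor witnesses are unique;
* `convergesOnTensors_and_rotationsInherited_of_ratio_tendsto` — hence the two clauses
  `ConvergesOnTensors 𝒞 m ∧ RotationsInheritedAt 𝒞 m` of the skeleton, UNFOLDED.

So `stub_heavyCalibration` is reduced to: above some `M_h'`, the heavy body's witness can be taken with
(Z) and with convergent ratios against ONE calibrated family — by the biting dictionary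
(`…HeavyCalibrationTransferTwoPoint`) and the tuned pinned family this is positivity of the limits
`c_T(s)` of the reference connected calibrating functions (Källén–Lehmann positivity + non-triviality of
every non-null species) and the sign of `zb`.  Def-free theorem file; everything here is proved.
-/

noncomputable section

namespace Summit.QuantumFields.QCD.Cruxes.RetypedContinuumComplement.VitaliMassDescent

open scoped BigOperators SchwartzMap
open MeasureTheory Filter Topology
open Literature.MathematicalPhysics.AQFT Literature.Probability.LatticeModels
  Literature.MathematicalPhysics.QuantumLattice Literature.MathematicalPhysics.QuantumFieldTheory
open Summit.QuantumFields.QCD.Cruxes.RotationRestoration.Birth.LatticeInvariancePassesToLimit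
  (isOffDiagonal_linActMulti isTensorOf_linActMulti_ofRealTest)

variable {Nf : ℕ}

/-! ### Reference limits: one-point, zero-point, sub-strings -/

/-- **Reference one-point functions converge** along a scheme that is QCD along `T`, to the
one-point Schwinger function of `T` on the canonical tensor witness. [folklore] -/
theorem tendsto_onePoint_of_isQCDAlong {sch : QCDScheme Nf} {T : OSData (QCDField Nf) 4}
    (hT : IsQCDAlong sch T) (s : QCDField Nf) (g : 𝓢((EuclideanSpace ℝ (Fin 4)), ℝ)) :
    Tendsto (fun k : ℕ => sch.onePoint k s g) atTop
      (𝓝 (T.schwinger 1 (fun _ => s) (SchwartzMap.tensorFin 1 fun _ => ofRealTest g))) :=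
  hT.2.2 1 one_ne_zero (fun _ => s) (fun _ => g) _ (isTensorOf_tensorFin _) (isOffDiagonal_of_subsingleton _)

/-- **The zero-point function**, once eventually `1`, converges to the zero-point Schwinger function
`𝔖₀ = 1` of `T` (E0) on the canonical (empty) tensor witness; stated at a general arity `c = 0`. [folklore] -/
theorem tendsto_zeroPoint_of_eventually {sch : QCDScheme Nf} (T : OSData (QCDField Nf) 4)
    (hZ : ∀ᶠ k in atTop, qcdLatticeSchwinger sch k 0 ![] ![] = 1) {c : ℕ} (hc : c = 0)
    (σ₀ : Fin c → QCDField Nf) (f₀ : Fin c → 𝓢((EuclideanSpace ℝ (Fin 4)), ℝ)) :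
    Tendsto (fun k : ℕ => qcdLatticeSchwinger sch k c σ₀ f₀) atTop
      (𝓝 (T.schwinger c σ₀ (SchwartzMap.tensorFin c fun j => ofRealTest (f₀ j)))) := by
  subst hc
  have h1 : T.schwinger 0 σ₀ (SchwartzMap.tensorFin 0 fun j => ofRealTest (f₀ j)) = 1 := by
    rw [T.normalized σ₀, SchwartzMap.tensorFin_apply, Finset.univ_eq_empty, Finset.prod_empty]
  have h2 : (fun k : ℕ => qcdLatticeSchwinger sch k 0 σ₀ f₀) = fun k => qcdLatticeSchwinger sch k 0 ![] ![] :=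
    funext fun k => congrArg₂ (qcdLatticeSchwinger sch k 0) (funext fun j => Fin.elim0 j)
      (funext fun j => Fin.elim0 j)
  rw [h1, h2]
  exact tendsto_const_nhds.congr' (hZ.mono fun k hk => hk.symm)

/-- The canonical one-point tensor witness of the zero test function is zero. [folklore] -/
theorem tensorFin_one_ofRealTest_zero :
    (SchwartzMap.tensorFin 1 fun _ : Fin 1 => ofRealTest (0 : 𝓢((EuclideanSpace ℝ (Fin 4)), ℝ))) = 0 := by
  ext x
  rw [SchwartzMap.tensorFin_apply, Fin.prod_univ_one, map_zero]
  rfl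

/-- **Reference sub-string terms converge.**  For an off-diagonal real tensor tuple `(σ, f)` and a
subset `B`, the product of the reference one-point functions off `B` with the reference function of
the sub-string `(σ, f) ∘ e_B` converges to the corresponding product of Schwinger functions of `T`
(sub-tensors are off-diagonal when no factor off `B` vanishes; otherwise both sides carry a zero
factor). [folklore] -/
theorem tendsto_subString_term {sch : QCDScheme Nf} {T : OSData (QCDField Nf) 4} (hT : IsQCDAlong sch T)
    (hZ : ∀ᶠ k in atTop, qcdLatticeSchwinger sch k 0 ![] ![] = 1) {n : ℕ} (σ : Fin n → QCDField Nf)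
    (f : Fin n → 𝓢((EuclideanSpace ℝ (Fin 4)), ℝ)) (F : 𝓢((Fin n → (EuclideanSpace ℝ (Fin 4))), ℂ)) (hF : IsTensorOf F fun i => ofRealTest (f i))
    (hO : IsOffDiagonal F) (B : Finset (Fin n)) :
    Tendsto (fun k : ℕ => (∏ i ∈ Bᶜ, sch.onePoint k (σ i) (f i)) *
        qcdLatticeSchwinger sch k B.card (fun j => σ (B.orderEmbOfFin rfl j))
          (fun j => f (B.orderEmbOfFin rfl j))) atTop
      (𝓝 ((∏ i ∈ Bᶜ, T.schwinger 1 (fun _ => σ i) (SchwartzMap.tensorFin 1 fun _ => ofRealTest (f i))) *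
        T.schwinger B.card (fun j => σ (B.orderEmbOfFin rfl j))
          (SchwartzMap.tensorFin B.card fun j => ofRealTest (f (B.orderEmbOfFin rfl j))))) := by
  classical
  by_cases hne : ∀ i, i ∉ B → f i ≠ 0
  · refine (tendsto_finsetProd _ fun i _ => tendsto_onePoint_of_isQCDAlong hT (σ i) (f i)).mul ?_
    rcases Nat.eq_zero_or_pos B.card with hcard | hcard
    · exact tendsto_zeroPoint_of_eventually T hZ hcard _ _
    · exact hT.2.2 B.card hcard.ne' _ _ _ (isTensorOf_tensorFin _)
        (isOffDiagonal_subTensor_ofRealTest hF hO B hne (isTensorOf_tensorFin _))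
  · obtain ⟨i, hi, hfi⟩ : ∃ i, i ∉ B ∧ f i = 0 := by
      by_contra h
      exact hne fun i hi hfi => h ⟨i, hi, hfi⟩
    have h0 : ∀ k : ℕ, (∏ i ∈ Bᶜ, sch.onePoint k (σ i) (f i)) = 0 := fun k =>
      Finset.prod_eq_zero (Finset.mem_compl.2 hi) (by rw [hfi]; exact QCDScheme.onePoint_zero _ _ _)
    have h0' : (∏ i ∈ Bᶜ, T.schwinger 1 (fun _ => σ i) (SchwartzMap.tensorFin 1 fun _ => ofRealTest (f i))) = 0 :=
      Finset.prod_eq_zero (Finset.mem_compl.2 hi) (by rw [hfi, tensorFin_one_ofRealTest_zero, map_zero])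
    simp only [h0, h0', zero_mul]
    exact tendsto_const_nhds

/-! ### Convergence of the calibrated functions -/

/-- **HEAVY CONVERGENCE OF THE CALIBRATED FUNCTIONS (conditional on the seams).**  Let the reference
scheme `reg.scheme m zb shiftb` be QCD along `T`, with `zb` never zero, zero-point function eventually
`1`, and convergent ratios `𝒞.z(m,s,k)/zb(s,k) → Λ_s`.  Then for every off-diagonal real tensor tuple
`(σ, f)` the calibrated `n`-point function converges along the full sequence, to
`(∏ᵢ Λ_{σᵢ}) Σ_B (−1)^{|Bᶜ|} ((∏_{i ∉ B} 𝔖₁^T(σᵢ; fᵢ)) 𝔖^T_{|B|}((σ, f) ∘ e_B))`. [cite: MontvayMunster1994, §1.7 (1.251)–(1.253) and §5.1] -/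
theorem tendsto_calibrated_heavy {reg : QCDRegularisation Nf} (𝒞 : CalibratedSpeciesFamily reg)
    (m : Fin Nf → ℝ) {zb shiftb : QCDField Nf → ℕ → ℝ} {T : OSData (QCDField Nf) 4}
    (hT : IsQCDAlong (reg.scheme m zb shiftb) T) (hzb : ∀ s k, zb s k ≠ 0)
    (hZ : ∀ᶠ k in atTop, qcdLatticeSchwinger (reg.scheme m zb shiftb) k 0 ![] ![] = 1)
    (Λ : QCDField Nf → ℝ) (hΛ : ∀ s, Tendsto (fun k : ℕ => 𝒞.z m s k / zb s k) atTop (𝓝 (Λ s)))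
    {n : ℕ} (σ : Fin n → QCDField Nf) (f : Fin n → 𝓢((EuclideanSpace ℝ (Fin 4)), ℝ)) (F : 𝓢((Fin n → (EuclideanSpace ℝ (Fin 4))), ℂ))
    (hF : IsTensorOf F fun i => ofRealTest (f i)) (hO : IsOffDiagonal F) :
    Tendsto (fun k : ℕ => qcdLatticeSchwinger (𝒞.scheme m) k n σ f) atTop
      (𝓝 ((∏ i, ((Λ (σ i) : ℝ) : ℂ)) *
        ∑ B : Finset (Fin n), (-1) ^ Bᶜ.card *
          ((∏ i ∈ Bᶜ, T.schwinger 1 (fun _ => σ i) (SchwartzMap.tensorFin 1 fun _ => ofRealTest (f i))) *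
            T.schwinger B.card (fun j => σ (B.orderEmbOfFin rfl j))
              (SchwartzMap.tensorFin B.card fun j => ofRealTest (f (B.orderEmbOfFin rfl j)))))) := by
  have he : (fun k : ℕ => qcdLatticeSchwinger (𝒞.scheme m) k n σ f) = fun k =>
      (∏ i, ((𝒞.z m (σ i) k / zb (σ i) k : ℝ) : ℂ)) *
        ∑ B : Finset (Fin n), (-1) ^ Bᶜ.card *
          ((∏ i ∈ Bᶜ, (reg.scheme m zb shiftb).onePoint k (σ i) (f i)) *
            qcdLatticeSchwinger (reg.scheme m zb shiftb) k B.card (fun j => σ (B.orderEmbOfFin rfl j))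
              (fun j => f (B.orderEmbOfFin rfl j))) := by
    funext k
    rw [calibrated_transfer 𝒞 m zb shiftb k σ (fun i => hzb (σ i) k) f]
    simp only [mul_assoc]
  rw [he]
  refine (tendsto_finsetProd _ fun i _ => ?_).mul (tendsto_finsetSum _ fun B _ =>
    tendsto_const_nhds.mul (tendsto_subString_term hT hZ σ f F hF hO B))
  exact (Complex.continuous_ofReal.tendsto _).comp (hΛ (σ i))

/-! ### Rotation invariance of the heavy limit -/

/-- The canonical one-point witness of a rotated real test function is the rotate of the canonical
witness (uniqueness of tensor witnesses). [folklore] -/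
theorem tensorFin_one_linActTest (R : (EuclideanSpace ℝ (Fin 4)) ≃ₗᵢ[ℝ] (EuclideanSpace ℝ (Fin 4))) (g : 𝓢((EuclideanSpace ℝ (Fin 4)), ℝ)) :
    (SchwartzMap.tensorFin 1 fun _ : Fin 1 => ofRealTest (linActTest (𝕜 := ℝ) R g)) =
      linActMulti R (SchwartzMap.tensorFin 1 fun _ : Fin 1 => ofRealTest g) :=
  IsTensorOf.unique (isTensorOf_tensorFin _)
    (isTensorOf_linActMulti_ofRealTest R (isTensorOf_tensorFin fun _ : Fin 1 => ofRealTest g))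

/-- The canonical witness of a rotated real sub-tuple is the rotate of the canonical witness. [folklore] -/
theorem tensorFin_linActTest {c : ℕ} (R : (EuclideanSpace ℝ (Fin 4)) ≃ₗᵢ[ℝ] (EuclideanSpace ℝ (Fin 4))) (g : Fin c → 𝓢((EuclideanSpace ℝ (Fin 4)), ℝ)) :
    (SchwartzMap.tensorFin c fun j => ofRealTest (linActTest (𝕜 := ℝ) R (g j))) =
      linActMulti R (SchwartzMap.tensorFin c fun j => ofRealTest (g j)) :=
  IsTensorOf.unique (isTensorOf_tensorFin _)
    (isTensorOf_linActMulti_ofRealTest R (isTensorOf_tensorFin fun j => ofRealTest (g j)))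

/-- **THE HEAVY LIMIT IS ROTATION INVARIANT**: for a proper rotation `R` of `ℝ⁴`, the limit value of
`tendsto_calibrated_heavy` is the same for the tuple `f` and for the rotated tuple `fᵢ ∘ R⁻¹`
(`linActTest R (f i)`), because E1 is a field of `T` and sub-tensors of off-diagonal tensors are
off-diagonal (terms with a vanishing factor off `B` are `0` on both sides). [folklore] -/
theorem heavyLimit_linAct (T : OSData (QCDField Nf) 4) (Λ : QCDField Nf → ℝ) {n : ℕ}
    (σ : Fin n → QCDField Nf) (f : Fin n → 𝓢((EuclideanSpace ℝ (Fin 4)), ℝ)) (F : 𝓢((Fin n → (EuclideanSpace ℝ (Fin 4))), ℂ))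
    (hF : IsTensorOf F fun i => ofRealTest (f i)) (hO : IsOffDiagonal F) (R : (EuclideanSpace ℝ (Fin 4)) ≃ₗᵢ[ℝ] (EuclideanSpace ℝ (Fin 4)))
    (hR : LinearMap.det (R.toLinearEquiv : (EuclideanSpace ℝ (Fin 4)) →ₗ[ℝ] (EuclideanSpace ℝ (Fin 4))) = 1) :
    (∏ i, ((Λ (σ i) : ℝ) : ℂ)) *
        ∑ B : Finset (Fin n), (-1) ^ Bᶜ.card *
          ((∏ i ∈ Bᶜ, T.schwinger 1 (fun _ => σ i)
              (SchwartzMap.tensorFin 1 fun _ => ofRealTest (linActTest (𝕜 := ℝ) R (f i)))) *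
            T.schwinger B.card (fun j => σ (B.orderEmbOfFin rfl j))
              (SchwartzMap.tensorFin B.card fun j =>
                ofRealTest (linActTest (𝕜 := ℝ) R (f (B.orderEmbOfFin rfl j))))) =
      (∏ i, ((Λ (σ i) : ℝ) : ℂ)) *
        ∑ B : Finset (Fin n), (-1) ^ Bᶜ.card *
          ((∏ i ∈ Bᶜ, T.schwinger 1 (fun _ => σ i) (SchwartzMap.tensorFin 1 fun _ => ofRealTest (f i))) *
            T.schwinger B.card (fun j => σ (B.orderEmbOfFin rfl j))
              (SchwartzMap.tensorFin B.card fun j => ofRealTest (f (B.orderEmbOfFin rfl j)))) := by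
  classical
  -- one-point factors: E1 on `⁰𝒮₁ = 𝒮`
  have h1 : ∀ i, T.schwinger 1 (fun _ => σ i)
      (SchwartzMap.tensorFin 1 fun _ => ofRealTest (linActTest (𝕜 := ℝ) R (f i))) =
      T.schwinger 1 (fun _ => σ i) (SchwartzMap.tensorFin 1 fun _ => ofRealTest (f i)) := fun i => by
    rw [tensorFin_one_linActTest]
    exact T.invariant.2 1 _ R hR _ (isOffDiagonal_of_subsingleton _)
  simp_rw [h1]
  refine congrArg _ (Finset.sum_congr rfl fun B _ => congrArg _ ?_)
  by_cases hne : ∀ i, i ∉ B → f i ≠ 0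
  · -- off-diagonal sub-tensor: E1 applies
    rw [tensorFin_linActTest]
    exact congrArg _ (T.invariant.2 B.card _ R hR _
      (isOffDiagonal_subTensor_ofRealTest hF hO B hne (isTensorOf_tensorFin _)))
  · -- a vanishing factor off `B`: both sides vanish
    obtain ⟨i, hi, hfi⟩ : ∃ i, i ∉ B ∧ f i = 0 := by
      by_contra h
      exact hne fun i hi hfi => h ⟨i, hi, hfi⟩
    have h0 : (∏ i ∈ Bᶜ, T.schwinger 1 (fun _ => σ i) (SchwartzMap.tensorFin 1 fun _ => ofRealTest (f i))) = 0 :=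
      Finset.prod_eq_zero (Finset.mem_compl.2 hi) (by rw [hfi, tensorFin_one_ofRealTest_zero, map_zero])
    rw [h0, zero_mul, zero_mul]

/-! ### The packaged heavy transfer -/

/-- **HEAVY TRANSFER AT A TUPLE (conditional on the seams).**  For every calibrated species family
`𝒞` over `reg` and every tuple `m`: if a reference scheme over `(reg, m)` IS QCD along OS data `T`,
its `zb` never vanishes, its zero-point function is eventually `1`, and every renormalisation ratio
`𝒞.z(m,s,k)/zb(s,k)` converges, then the calibrated family CONVERGES ON TENSORS at `m` and INHERITS
ROTATIONS at `m` — the two clauses `ConvergesOnTensors 𝒞 m ∧ RotationsInheritedAt 𝒞 m` of line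
`vitali-mass-descent`, unfolded.  (At a heavy tuple the reference scheme is the heavy body's witness;
the ratio convergence is the content left open: Källén–Lehmann positivity of the calibrating channel of
every non-null species, and the sign of `zb`.) [cite: MontvayMunster1994, §1.7 (1.251)–(1.253) and §5.1] -/
theorem convergesOnTensors_and_rotationsInherited_of_ratio_tendsto {reg : QCDRegularisation Nf}
    (𝒞 : CalibratedSpeciesFamily reg) (m : Fin Nf → ℝ) (zb shiftb : QCDField Nf → ℕ → ℝ)
    (T : OSData (QCDField Nf) 4) (hT : IsQCDAlong (reg.scheme m zb shiftb) T) (hzb : ∀ s k, zb s k ≠ 0)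
    (hZ : ∀ᶠ k in atTop, qcdLatticeSchwinger (reg.scheme m zb shiftb) k 0 ![] ![] = 1)
    (hratio : ∀ s, ∃ Λ : ℝ, Tendsto (fun k : ℕ => 𝒞.z m s k / zb s k) atTop (𝓝 Λ)) :
    (∀ n : ℕ, n ≠ 0 → ∀ (σ : Fin n → QCDField Nf) (f : Fin n → 𝓢((EuclideanSpace ℝ (Fin 4)), ℝ)) (F : 𝓢((Fin n → (EuclideanSpace ℝ (Fin 4))), ℂ)),
      IsTensorOf F (fun i => ofRealTest (f i)) → IsOffDiagonal F →
        ∃ c : ℂ, Tendsto (fun k : ℕ => qcdLatticeSchwinger (𝒞.scheme m) k n σ f) atTop (𝓝 c)) ∧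
    (∀ n : ℕ, n ≠ 0 → ∀ (σ : Fin n → QCDField Nf) (f : Fin n → 𝓢((EuclideanSpace ℝ (Fin 4)), ℝ)) (F : 𝓢((Fin n → (EuclideanSpace ℝ (Fin 4))), ℂ)),
      IsTensorOf F (fun i => ofRealTest (f i)) → IsOffDiagonal F →
        ∀ R : (EuclideanSpace ℝ (Fin 4)) ≃ₗᵢ[ℝ] (EuclideanSpace ℝ (Fin 4)), LinearMap.det (R.toLinearEquiv : (EuclideanSpace ℝ (Fin 4)) →ₗ[ℝ] (EuclideanSpace ℝ (Fin 4))) = 1 →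
          ∀ c c' : ℂ, Tendsto (fun k : ℕ => qcdLatticeSchwinger (𝒞.scheme m) k n σ f) atTop (𝓝 c) →
            Tendsto (fun k : ℕ => qcdLatticeSchwinger (𝒞.scheme m) k n σ
              (fun i => linActTest (𝕜 := ℝ) R (f i))) atTop (𝓝 c') → c' = c) := by
  choose Λ hΛ using hratio
  refine ⟨fun n _ σ f F hF hO => ⟨_, tendsto_calibrated_heavy 𝒞 m hT hzb hZ Λ hΛ σ f F hF hO⟩,
    fun n _ σ f F hF hO R hR c c' hc hc' => ?_⟩
  have h₁ := tendsto_calibrated_heavy 𝒞 m hT hzb hZ Λ hΛ σ f F hF hO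
  have h₂ := tendsto_calibrated_heavy 𝒞 m hT hzb hZ Λ hΛ σ (fun i => linActTest (𝕜 := ℝ) R (f i))
    (linActMulti R F) (isTensorOf_linActMulti_ofRealTest R hF) (isOffDiagonal_linActMulti R hO)
  rw [tendsto_nhds_unique hc h₁, tendsto_nhds_unique hc' h₂]
  exact heavyLimit_linAct T Λ σ f F hF hO R hR

end Summit.QuantumFields.QCD.Cruxes.RetypedContinuumComplement.VitaliMassDescent

end
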